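import Summits.BirchSwinnertonDyer.BirchSwinnertonDyer.Theorems.EisensteinPrimesResidualLineRigidity
import Summits.BirchSwinnertonDyer.BirchSwinnertonDyer.Theorems.SchneiderFreeAdditiveX3SemistableTwistLocalThree
import Summits.BirchSwinnertonDyer.BirchSwinnertonDyer.Theorems.CumulativeHeegnerLeopoldtCumulativeHeegnerInclusionAtThreeLineBaseChange
import Summits.BirchSwinnertonDyer.Rank1Residual.Additive.CyclotomicCharacterOnStableLine
import Literature.NumberTheory.GaloisRepresentations.FrobeniusGeneration
import Literature.NumberTheory.EllipticCurves.GeomReductionFrobeniusProofs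
import HarnessLib

/-!
# Route `SchneiderFreeAdditiveX3` (K1 door), crux r3 `GordTwoBranchIMC` (stmt-BirchSwinnertonDyer-19177): THE `D₃`-TRIVIAL LINE OF THE
# ANOMALOUS `(−3)`-TWIST AND THE LOCAL DICHOTOMY over `ℚ̄` — the kernel-of-reduction line of `V` twisted by `χ₋₃ = ω` is fixed
# pointwise by `D_𝔓` with quotient `ω`, so every `D_𝔓`-stable `3`-line of `W[3]`, `W = C • V^{(−3)}`, is either that line or is moved by
# inertia with `D_𝔓`-trivial quotient (Keller–Yin's orientation `(ω, 𝟙)`)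

Cell `bsd-schneider-ideate`, seat `bsd-schneider-door-c5` (prover, generation 31; assembly layer; `--supports` 19177, helper).
PARTITION: board row B6 ∩ X3 ∩ sst-twist, `r = 1` — the 1 725 ANOMALOUS pairs of the (G-ord, `e = 2`) half at `p = 3` (of 2 411).
bears_on: K1-door (items 18971/18972 retired → 19177 r3).  FILE 1 of the port of cell `bsd-eis`'s V21 INDEX ROAD (Keller–Yin
arXiv:2402.12781 Thm. 1.4.1 (iii), kernel modulo published facts for the GOOD anomalous lattice: x1 LEAD g4 `imprimLambdaLE_of_index`;
split-multiplicative twin: x2-p2 g10 `SplitMult*`) to the door's ANOMALOUS TWIN `W = C • V^{(−3)}`, `V` good ordinary with `a₃(V) ≡ 1 (mod 3)`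
(FINDING-door-c5-g28 §5b `stub_λW`).  The road is reduction-type-free except for three local inputs at `v̄`; this file and its `K`-level
sequel `…AnomalousTwistLocalData` supply the residual-level one — the analogue of x2's `ResidualDevissageSplitLocalData`.

MATHEMATICS.  `V/ℚ` globally minimal, good ordinary at `3` with `3 ∣ a₃(V) − 1`; `K₀ ≤ V[3]` the kernel of reduction.
(A) `exists_kernelLine_of_anomalous` (any odd `p`): EVERY `d ∈ D_𝔓` acts trivially on `V[p]/K₀` — Frobenius generation `d = φⁿ·i·u`
(`exists_eq_frobenius_pow_mul_of_mem_decompositionSubgroup`), reduction unchanged by inertia (`geomReduction_smul_of_mem_inertia`) and,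
anomalously, by Frobenius on `V[p]` (`geomReduction_smul_eq_self_of_dvd_frobeniusTrace_sub_one`); `#K₀ = p` as in generation 26's
`exists_kernelLine_frobenius`.  Hence `d` acts on `K₀` by `χ̄_p(d)` (`det = χ̄_p`: b2b's `MixedCongruence.smul_eq_cyclotomic_zsmul_of_forall_sub_mem`).
(B) `exists_trivLine_of_anomalous_pStar_twist`: along the sign-equivariant `e : W[3] ≃ V[3]` of `W = C • V^{(−3)}` (Silverman X.5.4,
`exists_signEquiv_of_twist`) the line `L₀ = e⁻¹K₀` is FIXED POINTWISE by `D_𝔓` — `e(d x) = ±d·e(x) = ±χ̄₃(d)·e(x)` with the sign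
`[d√−3 = √−3] = [χ̄₃(d) = 1]` (`smul_geomSqrt_neg_three_iff`: `χ₋₃ = ω`), and `(±1)² = 1` — while a Kummer inertia element `τ`
(`τ√−3 = −√−3`, `exists_mem_inertia_smul_geomSqrt_eq_neg`) acts by `−1` on `W[3]/L₀`; at every `𝔓 ∣ 3` by conjugation.
(C) `fix_or_quot_of_anomalous_pStar_twist`: for every `D_𝔓`-stable `Φ ≤ W[3]` of order `3`: EITHER `Φ = L₀` — `D_𝔓` fixes `Φ` pointwise and
`τ` is non-trivial on `W[3]/Φ` — OR `Φ ∩ L₀ = 0` — `τ` moves `Φ` and `D_𝔓` is trivial on `W[3]/Φ = (Φ ⊕ L₀)/Φ` (plane algebra).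
Only `p = 3` is anomalous for the door: at `p ≥ 5` the twist's inertia characters `ω^{(p±1)/2}` avoid `{𝟙, ω}` (generation 23).

HONEST FRAMING: unconditional helper theorems about elliptic curves over `ℚ` (no definition, no named fact, no `sorry`); nothing
analytic; no item closed; BSD proved for no curve; «closes rung: none».  References: Keller–Yin arXiv:2402.12781v2 §1.3 Prop. 1.3.1,
§1.4 Thm. 1.4.1 [KellerYin2024]; Serre 1972 §1.11 [Serre1972]; Mazur 1972 §5 [Mazur1972]; Silverman AEC X.5 Cor. 5.4 [SilvermanAEC2009];
Neukirch ANT I §9 [NeukirchANT1999]; x1 `IndexInputsAnomalousQuotient`, x2 `ResidualDevissageSplitLocalData` (templates).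
-/

set_option autoImplicit false
set_option linter.dupNamespace false

noncomputable section

open scoped Classical NumberField Pointwise

open WeierstrassCurve NumberField IsDedekindDomain Field Rat.HeightOneSpectrum
  Literature.NumberTheory.EllipticCurves Literature.NumberTheory.GaloisRepresentations
  Literature.NumberTheory.EllipticCurves.Rank1Residual Literature.NumberTheory.EllipticCurves.GreenbergSelmer
  Summit.BirchSwinnertonDyer.Rank1Residual Summit.BirchSwinnertonDyer.Rank1Residual.GaloisImage
  Summit.BirchSwinnertonDyer.Rank1Residual.Additive
  Summit.BirchSwinnertonDyer.BirchSwinnertonDyer.Theorems.SchneiderFreeAdditiveX3.SemistableTwistLocal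
  Summit.BirchSwinnertonDyer.BirchSwinnertonDyer.Theorems.SchneiderFreeAdditiveX3.SemistableTwistLocalThree

namespace Summit.BirchSwinnertonDyer.BirchSwinnertonDyer.Theorems.SchneiderFreeAdditiveX3.AnomalousTwistLocalLines

/-! ### §1(A) The kernel-of-reduction line at a good ordinary ANOMALOUS prime: `D_𝔓` is trivial on `V[p]/K₀` -/

section RatSide

variable {V W : WeierstrassCurve ℚ} [V.IsElliptic] [V.IsGloballyMinimal] {p : ℕ} [hp : Fact p.Prime]

/-- **The kernel-of-reduction line with `D_𝔓`-TRIVIAL quotient** (Serre 1972 §1.11 (1), Mazur's anomalous primes).  `V/ℚ` globally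
minimal, GOOD ORDINARY at the odd prime `p` with `p ∣ a_p(V) − 1`, `v` the place at `p`: there are a prime `𝔓` of `\bar ℤ` above `v` and a subgroup
`K₀ ≤ V[p]` of order `p` (the kernel of `red : V[p] → Ṽ(𝔽̄_p)`) with `d x − x ∈ K₀` for EVERY `d ∈ D_𝔓` and every `x ∈ V[p]`
(Frobenius generation; reduction is unchanged by inertia and — anomalously — by Frobenius on `V[p]`).  Generation 26's
`exists_kernelLine_frobenius` gave this for ONE inertia-corrected Frobenius and `a_p`; x1's `smul_sub_mem_rationalLine_of_mem_decompositionSubgroup`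
is the same statement keyed to a RAMIFIED rational line, which the door's `V` need not have.
[cite: Serre1972, §1.11 (1) and Prop. 11] [cite: Mazur1972, §5 (anomalous primes)] [cite: NeukirchANT1999, Ch. I §9 Prop. (9.4)] -/
theorem exists_kernelLine_of_anomalous (hp2 : p ≠ 2) (hV : GoodOrd V p) (ha : (p : ℤ) ∣ V.frobeniusTrace p - 1)
    {v : HeightOneSpectrum (𝓞 ℚ)} (hpv : ((p : ℕ) : 𝓞 ℚ) ∈ v.asIdeal) :
    ∃ 𝔓 ∈ v.primesAbove, ∃ K₀ : AddSubgroup (geomTorsion V (p : ℤ)), Nat.card K₀ = p ∧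
      ∀ d ∈ 𝔓.decompositionSubgroup (absoluteGaloisGroup ℚ), ∀ x : geomTorsion V (p : ℤ), d • x - x ∈ K₀ := by
  have hpP : p.Prime := hp.out
  haveI : NeZero p := ⟨hpP.ne_zero⟩
  have hv : (primesEquiv v : ℕ) = p := Literature.NumberTheory.EllipticCurves.primesEquiv_eq_of_natCast_mem hpP hpv
  have hΔ : ¬ (p : ℤ) ∣ minimalDiscriminantInt V :=
    V.not_dvd_minimalDiscriminantInt_of_hasGoodReductionAtPrime' p hV.1
  obtain ⟨𝔓, hmem, h𝔓⟩ := exists_ideal_placeOver p hv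
  obtain ⟨σ, hσ⟩ := HeightOneSpectrum.exists_isArithFrobAt_of_mem_primesAbove_holds (K := ℚ) (v := v) h𝔓
  -- the reduction map on `V[p]` and its kernel `K₀`
  set f : geomTorsion V (p : ℤ) →+ (reductionModPrime V p).geomPoints :=
    (geomReduction hΔ).comp (geomTorsion V (p : ℤ)).subtype with hf
  set K₀ : AddSubgroup (geomTorsion V (p : ℤ)) := f.ker with hK₀
  have hmemK : ∀ x : geomTorsion V (p : ℤ), x ∈ K₀ ↔ geomReduction hΔ (x : V.geomPoints) = 0 := fun x ↦ by
    rw [hK₀, AddMonoidHom.mem_ker]; rfl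
  have hxp : ∀ x : geomTorsion V (p : ℤ), (p : ℤ) • (x : V.geomPoints) = 0 := fun x ↦
    (Submodule.mem_torsionBy_iff _ _).mp x.2
  -- inertia acts trivially on `V[p]/K₀`
  have hKI : ∀ τ ∈ 𝔓.inertia (absoluteGaloisGroup ℚ), ∀ x : geomTorsion V (p : ℤ), τ • x - x ∈ K₀ := by
    intro τ hτ x
    rw [hmemK, AddSubgroupClass.coe_sub, AddSubgroup.torsionBy.coe_smul, map_sub,
      geomReduction_smul_of_mem_inertia hΔ hmem hτ, sub_self]
  -- every `d ∈ D_𝔓` acts trivially on `V[p]/K₀`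
  have hD : ∀ d ∈ 𝔓.decompositionSubgroup (absoluteGaloisGroup ℚ), ∀ x : geomTorsion V (p : ℤ), d • x - x ∈ K₀ := by
    intro d hd x
    obtain ⟨n, i, u, hi, hu', rfl⟩ := exists_eq_frobenius_pow_mul_of_mem_decompositionSubgroup h𝔓 hσ
      (CumulativeHeegnerInclusionAtThreeLineBaseChange.isOpen_iInf_stabilizer_geomTorsion V p) hd
    have huP : u • x = x := by
      have h : u • (x : V.geomPoints) = x := (Subgroup.mem_iInf.mp hu') x
      exact Subtype.ext (by rw [AddSubgroup.torsionBy.coe_smul]; exact h)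
    have hφk : ∀ (k : ℕ) (Q : geomTorsion V (p : ℤ)),
        geomReduction hΔ ((σ ^ k • Q : geomTorsion V (p : ℤ)) : V.geomPoints) =
          geomReduction hΔ (Q : V.geomPoints) := by
      intro k
      induction k with
      | zero => intro Q; rw [pow_zero, one_smul]
      | succ k ih =>
        intro Q
        rw [pow_succ, mul_smul, ih, AddSubgroup.torsionBy.coe_smul,
          geomReduction_smul_eq_self_of_dvd_frobeniusTrace_sub_one hΔ hmem hv h𝔓 hσ ha _ (hxp Q)]
    rw [hmemK, AddSubgroupClass.coe_sub, map_sub, mul_smul, mul_smul, huP, hφk n, AddSubgroup.torsionBy.coe_smul,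
      geomReduction_smul_of_mem_inertia hΔ hmem hi, sub_self]
  -- `K₀ ≠ ⊤`: the reduction is non-zero on `V[p]` (ordinary)
  obtain ⟨P, hP, hPred⟩ := exists_zsmul_eq_zero_geomReduction_ne_zero p hΔ hV.2
  set T₁ : geomTorsion V (p : ℤ) := ⟨P, (Submodule.mem_torsionBy_iff _ _).mpr hP⟩ with hT₁def
  have hT₁K : T₁ ∉ K₀ := by rw [hmemK]; exact hPred
  have hT₁ : T₁ ≠ 0 := by
    intro h0
    apply hPred
    have : (T₁ : V.geomPoints) = 0 := by rw [h0]; rfl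
    rw [show P = (T₁ : V.geomPoints) from rfl, this, map_zero]
  -- `K₀ ≠ ⊥`: an inertia element with `χ̄_p = −1` cannot act trivially on `V[p]` (determinant)
  have hKbot : K₀ ≠ ⊥ := by
    intro hbot
    obtain ⟨τ, hτI, hτχ⟩ := exists_mem_inertia_modPCyclotomicCharacterZMod_eq p hpv h𝔓 (-1)
    have htriv : ∀ x : geomTorsion V (p : ℤ), τ • x = x := fun x ↦ by
      have h := hKI τ hτI x
      rw [hbot, AddSubgroup.mem_bot, sub_eq_zero] at h
      exact h
    have h1 := intCast_eq_of_smul_eq_self_of_forall_sub_zsmul_mem V p hT₁ (htriv T₁) (a := 1)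
      (fun x ↦ by rw [htriv, one_zsmul, sub_self]; exact AddSubgroup.zero_mem _)
    rw [hτχ, Units.val_neg, Units.val_one, Int.cast_one] at h1
    have h2 : ((2 : ℕ) : ZMod p) = 0 := by
      rw [show ((2 : ℕ) : ZMod p) = 1 + 1 by norm_num]
      nth_rw 1 [← h1]
      exact neg_add_cancel 1
    rw [ZMod.natCast_eq_zero_iff] at h2
    exact hp2 ((Nat.prime_dvd_prime_iff_eq hpP Nat.prime_two).mp h2)
  -- `#K₀ = p`
  have hcardV : Nat.card (geomTorsion V (p : ℤ)) = p ^ 2 := Rank1Residual.natCard_geomTorsion V p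
  haveI : Finite (geomTorsion V (p : ℤ)) :=
    Nat.finite_of_card_ne_zero (by rw [hcardV]; exact pow_ne_zero _ hpP.ne_zero)
  have hKcard : Nat.card K₀ = p := by
    have hdvd : Nat.card K₀ ∣ p ^ 2 := hcardV ▸ K₀.card_addSubgroup_dvd_card
    obtain ⟨i, hi, hKi⟩ := (Nat.dvd_prime_pow hpP).mp hdvd
    interval_cases i
    · exact absurd (AddSubgroup.eq_bot_of_card_eq K₀ (by rw [hKi, pow_zero])) hKbot
    · rw [hKi, pow_one]
    · exfalso
      apply hT₁K
      rw [AddSubgroup.eq_top_of_card_eq K₀ (by rw [hKi, hcardV])]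
      exact AddSubgroup.mem_top _
  exact ⟨𝔓, h𝔓, K₀, hKcard, hD⟩


/-! ### §1(B) The `(−3)`-twist: `L₀ = e⁻¹(K₀) ≤ W[3]` is `D_𝔓`-TRIVIAL and a Kummer inertia element acts by `−1` on `W[3]/L₀` -/

omit [V.IsElliptic] [V.IsGloballyMinimal] in
/-- `p*`-cast at `p = 3`: `(−1)^{⌊3/2⌋}·3 = −3` in `ℚ`. [folklore] -/
theorem pStar_three : ((-1 : ℚ) ^ ((3 : ℕ) / 2) * ((3 : ℕ) : ℚ)) = -3 := by norm_num

omit [V.IsElliptic] [V.IsGloballyMinimal] in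
/-- In a `3`-torsion group, `−(2·y) = y`. [folklore] -/
theorem neg_two_zsmul_eq_self_of_three {p : ℕ} (hp3 : p = 3) (y : geomTorsion V (p : ℤ)) : -((2 : ℤ) • y) = y := by
  subst hp3
  have h3 : ((3 : ℕ) : ℤ) • y = 0 := by
    apply Subtype.ext
    rw [AddSubgroupClass.coe_zsmul, ZeroMemClass.coe_zero]
    exact (Submodule.mem_torsionBy_iff _ _).mp y.2
  have h2 : (2 : ℤ) • y = -y := by
    rw [show (2 : ℤ) = ((3 : ℕ) : ℤ) - 1 by norm_num, sub_zsmul, h3, one_zsmul]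
    simp
  rw [h2, neg_neg]

/-- **The `D_𝔓`-trivial line of the anomalous `(−3)`-twist, at the place's prime.**  `V/ℚ` globally minimal, good ordinary at
`p = 3` with `3 ∣ a₃(V) − 1`, `W = C • V^{(p*)}` (`p* = −3`): at the prime `𝔓` of (A) there is a line `L₀ ≤ W[3]` of order `3`
FIXED POINTWISE by `D_𝔓`, and an inertia element `τ ∈ I_𝔓` with `τ T + T ∈ L₀` for all `T ∈ W[3]` (`τ` acts by `−1` on
`W[3]/L₀`).  `L₀ = e⁻¹(K₀)` along the sign-equivariant `e : W[3] ≃ V[3]` (`exists_signEquiv_of_twist`); `d ∈ D_𝔓` acts on `K₀` by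
`χ̄₃(d)` (`MixedCongruence.smul_eq_cyclotomic_zsmul_of_forall_sub_mem`) and the sign of `e` at `d` is `[χ̄₃(d) = 1]`
(`smul_geomSqrt_neg_three_iff`), so `e(d x) = (±1)²·e(x)`; `τ` = a Kummer element `τ√−3 = −√−3`
(`exists_mem_inertia_smul_geomSqrt_eq_neg`).  Locally: `W[3]|_{D_𝔓} ⊇ L₀ ≅ 𝟙` with `W[3]/L₀ ≅ ω`.
[cite: KellerYin2024, §1.3 Prop. 1.3.1 (arXiv:2402.12781v2) (the local shape (ω, 𝟙)/(𝟙, ω))] [cite: SilvermanAEC2009, X.5 Cor. 5.4]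
[cite: Serre1972, §1.11 (1)] -/
theorem exists_trivLine_of_anomalous_pStar_twist_aux (hp3 : p = 3) (hV : GoodOrd V p)
    (ha : (p : ℤ) ∣ V.frobeniusTrace p - 1)
    (C : VariableChange ℚ) (hC : C • V.quadraticTwist ((-1 : ℚ) ^ (p / 2) * p) = W)
    {v : HeightOneSpectrum (𝓞 ℚ)} (hpv : ((p : ℕ) : 𝓞 ℚ) ∈ v.asIdeal) :
    ∃ 𝔓 ∈ v.primesAbove, ∃ L₀ : AddSubgroup (geomTorsion W (p : ℤ)), Nat.card L₀ = p ∧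
      (∀ d ∈ 𝔓.decompositionSubgroup (absoluteGaloisGroup ℚ), ∀ x ∈ L₀, d • x = x) ∧
      ∃ τ ∈ 𝔓.inertia (absoluteGaloisGroup ℚ), ∀ T : geomTorsion W (p : ℤ), τ • T + T ∈ L₀ := by
  have hp2 : p ≠ 2 := by omega
  obtain ⟨𝔓, h𝔓, K₀, hK₀, hDK⟩ := exists_kernelLine_of_anomalous hp2 hV ha hpv
  have hID : 𝔓.inertia (absoluteGaloisGroup ℚ) ≤ 𝔓.decompositionSubgroup (absoluteGaloisGroup ℚ) :=
    Ideal.inertia_le_decompositionSubgroup _ _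
  -- the twist parameter is `-3`
  have hd3 : ((-1 : ℚ) ^ (p / 2) * p) = ((-3 : ℤ) : ℚ) := by subst hp3; norm_num
  have hd0 : (((-3 : ℤ) : ℚ)) ≠ 0 := by norm_num
  have hC' : C⁻¹ • W = V.quadraticTwist (((-3 : ℤ) : ℚ)) := by rw [← hd3, ← hC, inv_smul_smul]
  obtain ⟨e, hpos, hneg⟩ := exists_signEquiv_of_twist (W := V) (Wd := W) (p := p) hd0 C⁻¹ hC'
  have hsqrt : geomSqrt (((-3 : ℤ) : ℚ)) = geomSqrt (-3 : ℚ) := by norm_num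
  -- `L₀ = e⁻¹ K₀`
  set L₀ : AddSubgroup (geomTorsion W (p : ℤ)) := K₀.comap e.toAddMonoidHom with hL₀
  have hmem : ∀ T : geomTorsion W (p : ℤ), T ∈ L₀ ↔ e T ∈ K₀ := fun _ ↦ Iff.rfl
  have hL₀card : Nat.card L₀ = p := by
    have h : Nat.card L₀ = Nat.card K₀ := Nat.card_congr
      { toFun := fun x ↦ ⟨e x.1, x.2⟩
        invFun := fun y ↦ ⟨e.symm y.1, by
          change e (e.symm y.1) ∈ K₀
          rw [e.apply_symm_apply]; exact y.2⟩
        left_inv := fun x ↦ Subtype.ext (e.symm_apply_apply x.1)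
        right_inv := fun y ↦ Subtype.ext (e.apply_symm_apply y.1) }
    exact h.trans hK₀
  -- `d ∈ D_𝔓` acts on `K₀` by `χ̄_p(d)`
  have hK₀act : ∀ d ∈ 𝔓.decompositionSubgroup (absoluteGaloisGroup ℚ), ∀ y ∈ K₀,
      d • y = (((modPCyclotomicCharacterZMod ℚ p d : (ZMod p)ˣ) : ZMod p).val : ℤ) • y :=
    fun d hd y hy ↦ MixedCongruence.smul_eq_cyclotomic_zsmul_of_forall_sub_mem V p d hK₀ (hDK d hd) hy
  -- a unit of `(ZMod 3)ˣ` other than `1` has value `2`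
  have hval : ∀ u : (ZMod p)ˣ, u ≠ 1 → ((u : ZMod p).val : ℤ) = 2 := by
    subst hp3
    intro u hu
    have hlt : (u : ZMod 3).val < 3 := ZMod.val_lt _
    have h0 : (u : ZMod 3).val ≠ 0 := fun h ↦ u.ne_zero ((ZMod.val_eq_zero _).mp h)
    have h1 : (u : ZMod 3).val ≠ 1 := by
      intro h
      apply hu
      apply Units.ext
      apply ZMod.val_injective 3
      rw [h, Units.val_one, ZMod.val_one]
    omega
  refine ⟨𝔓, h𝔓, L₀, hL₀card, fun d hd x hx ↦ ?_, ?_⟩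
  · -- `D_𝔓` fixes `L₀` pointwise
    have hx' : e x ∈ K₀ := (hmem x).mp hx
    apply e.injective
    by_cases hfix : d • geomSqrt (((-3 : ℤ) : ℚ)) = geomSqrt (((-3 : ℤ) : ℚ))
    · have hχ : modPCyclotomicCharacterZMod ℚ p d = 1 := by
        subst hp3
        exact (MixedCongruence.smul_geomSqrt_neg_three_iff d).mp (by rwa [hsqrt] at hfix)
      rw [hpos d hfix, hK₀act d hd _ hx', hχ, Units.val_one]
      subst hp3
      rw [ZMod.val_one, Nat.cast_one, one_zsmul]
    · have hχ : modPCyclotomicCharacterZMod ℚ p d ≠ 1 := by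
        subst hp3
        exact fun h ↦ hfix (by rw [hsqrt]; exact (MixedCongruence.smul_geomSqrt_neg_three_iff d).mpr h)
      rw [hneg d hfix, hK₀act d hd _ hx', hval _ hχ, neg_two_zsmul_eq_self_of_three hp3]
  · -- a Kummer inertia element acts by `-1` on `W[3]/L₀`
    have hpP : p.Prime := hp.out
    have h2v : (2 : 𝓞 ℚ) ∉ v.asIdeal := two_not_mem_of_natCast_prime_mem hpP hp2 hpv
    have hd : v.intValuation (((-3 : ℤ) : 𝓞 ℚ)) = WithZero.exp (-1 : ℤ) := by
      have h := intValuation_pStar p hpv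
      have hint : ((-1 : ℤ) ^ (p / 2) * p : ℤ) = -3 := by subst hp3; norm_num
      rwa [hint] at h
    obtain ⟨τ, hτI, hτ⟩ := exists_mem_inertia_smul_geomSqrt_eq_neg (E := ℚ) hd h2v h𝔓
    have hcoe : ((((-3 : ℤ) : 𝓞 ℚ)) : ℚ) = (((-3 : ℤ) : ℚ)) := by
      rw [RingOfIntegers.coe_eq_algebraMap, map_intCast]
    rw [hcoe] at hτ
    have hτne : ¬ τ • geomSqrt (((-3 : ℤ) : ℚ)) = geomSqrt (((-3 : ℤ) : ℚ)) := by
      rw [hτ]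
      intro h
      exact geomSqrt_ne_zero hd0 (neg_eq_self.mp h)
    refine ⟨τ, hτI, fun T ↦ ?_⟩
    rw [hmem, map_add, hneg τ hτne]
    have h := K₀.neg_mem (hDK τ (hID hτI) (e T))
    rwa [neg_sub, sub_eq_neg_add] at h

/-- **The same at EVERY prime `𝔓` of `\bar ℤ` above `3`** (conjugation `𝔓 = ρ • 𝔓₀`: `D_𝔓 = ρ D_{𝔓₀} ρ⁻¹`, `I_𝔓 = ρ I_{𝔓₀} ρ⁻¹`,
`L₀ ↦ ρ L₀`, `τ ↦ ρ τ ρ⁻¹`). [cite: NeukirchANT1999, Ch. I §9 Prop. (9.4)–(9.6)] [cite: KellerYin2024, §1.3 Prop. 1.3.1 (arXiv:2402.12781v2)] -/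
theorem exists_trivLine_of_anomalous_pStar_twist (hp3 : p = 3) (hV : GoodOrd V p)
    (ha : (p : ℤ) ∣ V.frobeniusTrace p - 1)
    (C : VariableChange ℚ) (hC : C • V.quadraticTwist ((-1 : ℚ) ^ (p / 2) * p) = W)
    {v : HeightOneSpectrum (𝓞 ℚ)} (hpv : ((p : ℕ) : 𝓞 ℚ) ∈ v.asIdeal)
    {𝔓 : Ideal (absIntegers (𝓞 ℚ) ℚ)} (h𝔓 : 𝔓 ∈ v.primesAbove) :
    ∃ L₀ : AddSubgroup (geomTorsion W (p : ℤ)), Nat.card L₀ = p ∧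
      (∀ d ∈ 𝔓.decompositionSubgroup (absoluteGaloisGroup ℚ), ∀ x ∈ L₀, d • x = x) ∧
      ∃ τ ∈ 𝔓.inertia (absoluteGaloisGroup ℚ), ∀ T : geomTorsion W (p : ℤ), τ • T + T ∈ L₀ := by
  obtain ⟨𝔓₀, h𝔓₀, L₀, hL₀, hfix, τ, hτI, hτ⟩ := exists_trivLine_of_anomalous_pStar_twist_aux hp3 hV ha C hC hpv
  obtain ⟨ρ, hρ⟩ := IsDedekindDomain.HeightOneSpectrum.exists_smul_eq_of_mem_primesAbove_holds h𝔓₀ h𝔓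
  -- conjugation into `D_{𝔓₀}` / out of `I_{𝔓₀}`
  have hconj' : ∀ g ∈ 𝔓.decompositionSubgroup (absoluteGaloisGroup ℚ),
      ρ⁻¹ * g * ρ ∈ 𝔓₀.decompositionSubgroup (absoluteGaloisGroup ℚ) := by
    intro g hg
    rw [← hρ, Ideal.decompositionSubgroup_smul, Subgroup.mem_pointwise_smul_iff_inv_smul_mem, MulAut.smul_def,
      MulAut.conj_inv_apply] at hg
    exact hg
  have hτ' : ρ * τ * ρ⁻¹ ∈ 𝔓.inertia (absoluteGaloisGroup ℚ) := by
    rw [← hρ, Ideal.inertia_smul]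
    have := Subgroup.smul_mem_pointwise_smul τ (MulAut.conj ρ) _ hτI
    simpa only [MulAut.smul_def, MulAut.conj_apply] using this
  -- the conjugated line `ρ L₀`
  let f := DistribSMul.toAddMonoidHom (geomTorsion W (p : ℤ)) ρ
  refine ⟨L₀.map f, ResidualLineRigidity.natCard_map_eq ρ hL₀, fun g hg P' hP' ↦ ?_, ρ * τ * ρ⁻¹, hτ', fun T ↦ ?_⟩
  · obtain ⟨P, hP, rfl⟩ := AddSubgroup.mem_map.mp hP'
    change g • (ρ • P) = ρ • P
    have h := hfix _ (hconj' g hg) P hP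
    rw [mul_smul, mul_smul] at h
    have h' := congrArg (ρ • ·) h
    simpa only [smul_inv_smul] using h'
  · refine AddSubgroup.mem_map.mpr ⟨τ • (ρ⁻¹ • T) + ρ⁻¹ • T, hτ (ρ⁻¹ • T), ?_⟩
    change ρ • (τ • (ρ⁻¹ • T) + ρ⁻¹ • T) = (ρ * τ * ρ⁻¹) • T + T
    rw [smul_add, smul_inv_smul, mul_smul, mul_smul]

/-! ### §1(C) The dichotomy for every `D_𝔓`-stable line of `W[3]` -/

variable [W.IsElliptic]

/-- **LOCAL DICHOTOMY for the anomalous `(−3)`-twist, every prime `𝔓 ∣ 3` of `\bar ℤ`.**  `V/ℚ` globally minimal, good ordinary at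
`p = 3` with `3 ∣ a₃(V) − 1`, `W = C • V^{(p*)}`; `Φ ≤ W[3]` ANY subgroup of order `3` stable under `D_𝔓`.  Then EITHER `D_𝔓` fixes `Φ`
pointwise and some inertia element is non-trivial on `W[3]/Φ` («`Φ|_{D_𝔓} ≅ 𝟙`, quotient `ω`» — the shape Keller–Yin's lattice
normalisation of arXiv:2410.23241 §3.3 EXCLUDES), OR some inertia element moves `Φ` and `D_𝔓` is trivial on `W[3]/Φ` («`Φ|_{D_𝔓} ≅ ω`,
quotient `𝟙`» — x1's orientation `(ω, 𝟙)`).  (B) and plane algebra: `Φ = L₀` or `Φ ⊕ L₀ = W[3]`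
(`SemistableTwistLocalAnyLine.inf_eq_bot_and_sup_eq_top_of_ne`). The door analogue of x2's `fix_or_quot_of_split_of_mem_primesAbove`.
[cite: KellerYin2024, §1.3 Prop. 1.3.1 and §1.4 Thm. 1.4.1 (iii) (arXiv:2402.12781v2)] [cite: Serre1972, §1.11] -/
theorem fix_or_quot_of_anomalous_pStar_twist (hp3 : p = 3) (hV : GoodOrd V p)
    (ha : (p : ℤ) ∣ V.frobeniusTrace p - 1)
    (C : VariableChange ℚ) (hC : C • V.quadraticTwist ((-1 : ℚ) ^ (p / 2) * p) = W)
    {v : HeightOneSpectrum (𝓞 ℚ)} (hpv : ((p : ℕ) : 𝓞 ℚ) ∈ v.asIdeal)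
    {𝔓 : Ideal (absIntegers (𝓞 ℚ) ℚ)} (h𝔓 : 𝔓 ∈ v.primesAbove)
    {Φ : AddSubgroup (geomTorsion W (p : ℤ))} (hΦ : Nat.card Φ = p)
    (hΦst : ∀ g ∈ 𝔓.decompositionSubgroup (absoluteGaloisGroup ℚ), ∀ P ∈ Φ, g • P ∈ Φ) :
    ((∀ g ∈ 𝔓.decompositionSubgroup (absoluteGaloisGroup ℚ), ∀ P ∈ Φ, g • P = P) ∧
        ∃ g ∈ 𝔓.inertia (absoluteGaloisGroup ℚ), ∃ P : geomTorsion W (p : ℤ), g • P - P ∉ Φ) ∨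
      ((∃ g ∈ 𝔓.inertia (absoluteGaloisGroup ℚ), ∃ P ∈ Φ, g • P ≠ P) ∧
        ∀ g ∈ 𝔓.decompositionSubgroup (absoluteGaloisGroup ℚ), ∀ P : geomTorsion W (p : ℤ), g • P - P ∈ Φ) := by
  have hpP : p.Prime := hp.out
  have hp2 : p ≠ 2 := by omega
  have hID : 𝔓.inertia (absoluteGaloisGroup ℚ) ≤ 𝔓.decompositionSubgroup (absoluteGaloisGroup ℚ) :=
    Ideal.inertia_le_decompositionSubgroup _ _
  obtain ⟨L₀, hL₀, hfix, τ, hτI, hτ⟩ := exists_trivLine_of_anomalous_pStar_twist hp3 hV ha C hC hpv h𝔓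
  rcases line_eq_or_inf_eq_bot hΦ hL₀ with heq | hinf
  · -- `Φ = L₀`
    subst heq
    refine Or.inl ⟨hfix, τ, hτI, ?_⟩
    obtain ⟨Q₀, hQ₀⟩ := exists_not_mem_of_natCard_eq hΦ
    refine ⟨Q₀, fun hsub ↦ hQ₀ ?_⟩
    -- `(τQ₀ + Q₀) − (τQ₀ − Q₀) = 2Q₀ ∈ Φ`
    have h2 : (τ • Q₀ + Q₀) - (τ • Q₀ - Q₀) = (2 : ℤ) • Q₀ := by rw [two_zsmul]; abel
    exact mem_of_two_zsmul_mem hp2 (h2 ▸ Φ.sub_mem (hτ Q₀) hsub)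
  · -- `Φ ∩ L₀ = 0`, so `Φ ⊔ L₀ = W[p]`
    have hne : Φ ≠ L₀ := by
      intro h
      rw [h, inf_idem] at hinf
      have h1 : Nat.card L₀ = 1 := by rw [hinf]; exact AddSubgroup.card_bot
      exact hpP.one_lt.ne' (hL₀.symm.trans h1)
    obtain ⟨-, hsup⟩ := SemistableTwistLocalAnyLine.inf_eq_bot_and_sup_eq_top_of_ne hpP
      (Rank1Residual.natCard_geomTorsion W p) hΦ hL₀ hne
    refine Or.inr ⟨?_, fun g hg P ↦ ?_⟩
    · -- `τ` moves `Φ`: `τ P₀ = −P₀ ≠ P₀`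
      obtain ⟨P₀, hP₀Φ, hP₀⟩ := exists_mem_ne_zero_of_natCard_eq hΦ
      refine ⟨τ, hτI, P₀, hP₀Φ, fun h ↦ hP₀ ?_⟩
      have h1 : τ • P₀ + P₀ ∈ Φ ⊓ L₀ := ⟨Φ.add_mem (hΦst τ (hID hτI) P₀ hP₀Φ) hP₀Φ, hτ P₀⟩
      rw [hinf, AddSubgroup.mem_bot, h, ← two_zsmul] at h1
      exact mem_of_two_zsmul_mem (L := (⊥ : AddSubgroup (geomTorsion W (p : ℤ)))) hp2 h1
    · -- `D_𝔓` trivial on `W[p]/Φ`: write `P = a + b`, `a ∈ Φ`, `b ∈ L₀`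
      have hP : P ∈ Φ ⊔ L₀ := by rw [hsup]; exact AddSubgroup.mem_top P
      obtain ⟨a, ha', b, hb, rfl⟩ := AddSubgroup.mem_sup.mp hP
      have h : g • (a + b) - (a + b) = g • a - a := by rw [smul_add, hfix g hg b hb]; abel
      rw [h]
      exact Φ.sub_mem (hΦst g hg a ha') ha'

end RatSide

end Summit.BirchSwinnertonDyer.BirchSwinnertonDyer.Theorems.SchneiderFreeAdditiveX3.AnomalousTwistLocalLines

end
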